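import Literature.AlgebraicGeometry.Motives.AbelianVarietySemilinearMaps
import Literature.AlgebraicGeometry.Motives.GaloisDescentAbelianVariety
import Literature.AlgebraicGeometry.Motives.ComplexAutGaloisDescent
import HarnessLib

/-!
# Descent of a semilinear `Aut(ℂ/k)`-action on `B ⊗_{k₂} ℂ`, trivial on `Aut(ℂ/k₂)`, to a Galois descent datum on `B`
# (Shimura 1998, §21.1 proof of Prop. 21.1 pp. 145–146 and §21.4 proof of Thm. 21.4 pp. 147–148; Milne 2005, Prop. 13.1; Görtz–Wedhorn I §(14.20))

Topic `Literature/AlgebraicGeometry/Motives`, namespace `Literature.AlgebraicGeometry.Motives.AbelianVariety`.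
THEOREMS ONLY (no definition, no named fact; net Literature debt 0).  Cell `hodgecm-mathlib` (D-0151), fan A,
rung A-II, line `a2b-twisted-galois-model`, stub TM `stub_twistedModelOfFiniteLevel`.

Shimura, proof of Prop. 21.1 (pp. 145–146): «we can find a finite Galois extension `k₂` of `k₀` […] and the `f_σ` are all
rational over `k₂` […] `f_{στ} = f_σ^τ f_τ` […] Therefore by a well known criterion (see [W5]) we can find …»; proof of
Thm. 21.4 (pp. 147–148): «for the same reason as in the proof of Proposition 21.1, we can find a `k`-rational structure».
The «well known criterion» is Weil's Galois descent, in the tree `GaloisDescentAbelianVariety.exists_iso_baseChange` /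
`AbelianVarietyStructureDescent`, which CONSUMES a semilinear action of `Gal(k₂/k)` on a `k₂`-model
(`RelativeSpec.ActionOver` with the compatibilities `hmul`, `hone`, `hinv`).  This file PRODUCES that datum from what
Shimura's `λ_σ` give on the complex fibre:

**`exists_actionOver_of_semilinear`.**  Let `k → k₂ → ℂ` be a tower of fields with `k₂` countable, such that every
`τ ∈ Aut(k₂/k)` extends to some `σ ∈ Aut(ℂ/k)`.  Let `B` be an abelian variety over `k₂` and `F : Aut(ℂ/k) → Aut(B_ℂ)`
(`B_ℂ = B ⊗_{k₂} ℂ` as a scheme) a family of semilinear group automorphisms — `F σ` covers `Spec σ`, respects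
`m`, `0`, `i` of the `ℂ`-group scheme `B_ℂ` (`Motives/AbelianVarietySemilinearMaps`) — which is multiplicative
(`F(στ) = F σ ≫ F τ`, the cocycle relation) and restricts on `Aut(ℂ/k₂)` to the Galois automorphisms `1 × Spec θ` of
`B ⊗_{k₂} ℂ` (`F θ = B.gal ℂ θ⁻¹`).  Then there is a semilinear action `ρ` of `Aut(k₂/k)` on the `k`-scheme `B`
(`ρ_τ` covering `Spec τ⁻¹`, the tree's convention of `AbelianVariety.gal`) compatible with `m`, `0`, `i`, commuting with
every endomorphism `g` of `B` whose complexification commutes with the `F σ`, and LINKED to `F` by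
`F σ ≫ pr = pr ≫ ρ_{τ⁻¹}` whenever `σ` extends `τ` (`pr : B_ℂ → B`).  Each `ρ_τ` is obtained by descending
`F σ ≫ pr` (for `σ` extending `τ⁻¹`) along `ℂ/k₂` into the twist `B → Spec k₂ →(Spec τ) Spec k₂`, by
`GaloisDescent.existsUnique_map_eq_complex` (Milne 2005 Prop. 13.1: the functor `V ↦ (V_ℂ, Aut(ℂ/k₂)-action)` is
fully faithful) — the `Aut(ℂ/k₂)`-equivariance of `F σ ≫ pr` being exactly the two hypotheses (cocycle + triviality on
`Aut(ℂ/k₂)`); the group law and the compatibilities are checked after the faithfully flat `pr` and `pr × pr`.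

## References

* [Shimura1998] G. Shimura, *Abelian Varieties with Complex Multiplication and Modular Functions* (1998), §21.1 proof
  of Prop. 21.1 pp. 145–146; §21.4 proof of Thm. 21.4 pp. 147–148.
* [Milne2005ShimuraVarieties] J. S. Milne, *Introduction to Shimura varieties* (2005/2017), §13 Prop. 13.1 p. 117.
* [GortzWedhorn2020] U. Görtz, T. Wedhorn, *Algebraic Geometry I* (2nd ed. 2020), §(14.20), Thm. 14.72 (1).
-/

noncomputable section

open CategoryTheory CategoryTheory.Limits AlgebraicGeometry MonoidalCategory CartesianMonoidalCategory Cardinal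

namespace Literature.AlgebraicGeometry.Motives

namespace AbelianVariety

open scoped MonObj
open Literature.AlgebraicGeometry.RelativeSpec (ActionOver)

set_option backward.isDefEq.respectTransparency false

variable {k k₂ : Type} [Field k] [Field k₂] [Algebra k k₂] [Algebra k ℂ] [Algebra k₂ ℂ] [IsScalarTower k k₂ ℂ]

/-! ## §1 Automorphisms of `ℂ` over `k` and `k₂` -/

omit [IsScalarTower k k₂ ℂ] in
/-- If `σ ∈ Aut(ℂ/k)` restricts to `τ ∈ Aut(k₂/k)` on `k₂`, then `Spec σ ≫ (Spec ℂ → Spec k₂) = (Spec ℂ → Spec k₂) ≫ Spec τ`.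
[cite: GortzWedhorn2020, §(14.20)] -/
theorem specMap_comp_bcSpec_of_restrict (σ : ℂ ≃ₐ[k] ℂ) (τ : k₂ ≃ₐ[k] k₂)
    (h : ∀ x : k₂, σ (algebraMap k₂ ℂ x) = algebraMap k₂ ℂ (τ x)) :
    Spec.map (CommRingCat.ofHom σ.toRingEquiv.toRingHom) ≫ bcSpec k₂ ℂ = bcSpec k₂ ℂ ≫ specAut k₂ τ := by
  change Spec.map _ ≫ Spec.map _ = Spec.map _ ≫ Spec.map _
  rw [← Spec.map_comp, ← Spec.map_comp, ← CommRingCat.ofHom_comp, ← CommRingCat.ofHom_comp]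
  congr 2
  exact RingHom.ext fun x => h x

omit [Algebra k k₂] [IsScalarTower k k₂ ℂ] in
/-- An automorphism of `ℂ` over `k` fixing `k₂` pointwise, as an automorphism over `k₂` (same underlying map).
[cite: Milne2005ShimuraVarieties, §13 Prop. 13.1 p. 117] -/
theorem exists_algEquiv_of_forall_apply_algebraMap (δ : ℂ ≃ₐ[k] ℂ)
    (h : ∀ x : k₂, δ (algebraMap k₂ ℂ x) = algebraMap k₂ ℂ x) :
    ∃ δ₂ : ℂ ≃ₐ[k₂] ℂ, ∀ z, δ₂ z = δ z :=
  ⟨AlgEquiv.ofRingEquiv (f := δ.toRingEquiv) h, fun _ => rfl⟩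

/-! ## §2 Descent of one semilinear automorphism into the twist `B → Spec k₂ →(Spec τ) Spec k₂` -/

section Descent

variable (B : AbelianVariety k₂) (F : (ℂ ≃ₐ[k] ℂ) → ((B.baseChange ℂ).X.left ⟶ (B.baseChange ℂ).X.left))
  (hF : ∀ σ, F σ ≫ (B.baseChange ℂ).X.hom =
    (B.baseChange ℂ).X.hom ≫ Spec.map (CommRingCat.ofHom σ.toRingEquiv.toRingHom))
  (hmulF : ∀ σ τ, F (σ * τ) = F σ ≫ F τ)
  (hgalF : ∀ (θ : ℂ ≃ₐ[k] ℂ) (θ₂ : ℂ ≃ₐ[k₂] ℂ), (∀ z, θ₂ z = θ z) → F θ = B.gal ℂ θ₂⁻¹)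

omit [IsScalarTower k k₂ ℂ] in
include hmulF hgalF in
/-- **`F σ ≫ pr` depends only on `σ|_{k₂}`**: if `σ, σ′ ∈ Aut(ℂ/k)` agree on `k₂` then `F σ′ = F σ ≫ F(σ⁻¹σ′)` with
`σ⁻¹σ′ ∈ Aut(ℂ/k₂)` acting as `1 × Spec`, which the projection `pr : B_ℂ → B` ignores.
[cite: Shimura1998, §21.4, proof of Thm. 21.4 (pp. 147–148) («c = 1 if … λ is uniquely determined by σ»)] -/
theorem comp_fst_eq_of_restrict_eq (σ σ' : ℂ ≃ₐ[k] ℂ) (τ : k₂ ≃ₐ[k] k₂)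
    (h : ∀ x : k₂, σ (algebraMap k₂ ℂ x) = algebraMap k₂ ℂ (τ x))
    (h' : ∀ x : k₂, σ' (algebraMap k₂ ℂ x) = algebraMap k₂ ℂ (τ x)) :
    F σ' ≫ pullback.fst B.X.hom (bcSpec k₂ ℂ) = F σ ≫ pullback.fst B.X.hom (bcSpec k₂ ℂ) := by
  have hδ : ∀ x : k₂, (σ⁻¹ * σ') (algebraMap k₂ ℂ x) = algebraMap k₂ ℂ x := fun x => by
    rw [AlgEquiv.mul_apply, h', ← h, ← AlgEquiv.mul_apply, inv_mul_cancel, AlgEquiv.one_apply]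
  obtain ⟨δ₂, hδ₂⟩ := exists_algEquiv_of_forall_apply_algebraMap (σ⁻¹ * σ') hδ
  have hσ' : σ' = σ * (σ⁻¹ * σ') := (mul_inv_cancel_left σ σ').symm
  rw [hσ', hmulF, hgalF (σ⁻¹ * σ') δ₂ hδ₂, Category.assoc, gal_fst]

include hF hmulF hgalF in
/-- **Descent of `F σ ≫ pr` to the twist of `B` by `τ`**, for `σ ∈ Aut(ℂ/k)` extending `τ⁻¹`: there is a
`k`-morphism `f : B → B` covering `Spec τ⁻¹` with `pr ≫ f = F σ ≫ pr` — the `ℂ`-morphism `(F σ ≫ pr, p) : B_ℂ → (B^τ)_ℂ`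
(`B^τ = (B → Spec k₂ → Spec k₂)` the twist by composition) commutes with the `Aut(ℂ/k₂)`-actions `1 × Spec θ⁻¹`
(cocycle + triviality of `F` on `Aut(ℂ/k₂)`), hence descends (Milne 2005 Prop. 13.1,
`GaloisDescent.existsUnique_map_eq_complex`). [cite: Milne2005ShimuraVarieties, §13 Prop. 13.1 p. 117] [cite: Shimura1998, §21.1, proof of Prop. 21.1 (pp. 145–146); §21.4, proof of Thm. 21.4 (pp. 147–148)] -/
theorem exists_descent_of_semilinear (hk₂ : #k₂ ≤ ℵ₀) (τ : k₂ ≃ₐ[k] k₂) (σ : ℂ ≃ₐ[k] ℂ)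
    (hσ : ∀ x : k₂, σ (algebraMap k₂ ℂ x) = algebraMap k₂ ℂ (τ⁻¹ x)) :
    ∃ f : B.X.left ⟶ B.X.left, f ≫ B.X.hom = B.X.hom ≫ specAut k₂ τ⁻¹ ∧
      pullback.fst B.X.hom (bcSpec k₂ ℂ) ≫ f = F σ ≫ pullback.fst B.X.hom (bcSpec k₂ ℂ) := by
  -- the twist `Y = (B → Spec k₂ →(Spec τ) Spec k₂)` and the `ℂ`-morphism `g : B_ℂ → Y_ℂ`
  let Y : SchemeOver k₂ := Over.mk (B.X.hom ≫ specAut k₂ τ)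
  have hSbc : Spec.map (CommRingCat.ofHom σ.toRingEquiv.toRingHom) ≫ bcSpec k₂ ℂ =
      bcSpec k₂ ℂ ≫ specAut k₂ τ⁻¹ := specMap_comp_bcSpec_of_restrict σ τ⁻¹ hσ
  have hw : (F σ ≫ pullback.fst B.X.hom (bcSpec k₂ ℂ)) ≫ Y.hom =
      pullback.snd B.X.hom (bcSpec k₂ ℂ) ≫ bcSpec k₂ ℂ := by
    change (F σ ≫ pullback.fst B.X.hom (bcSpec k₂ ℂ)) ≫ B.X.hom ≫ specAut k₂ τ = _
    rw [Category.assoc, pullback.condition_assoc]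
    change F σ ≫ (B.baseChange ℂ).X.hom ≫ bcSpec k₂ ℂ ≫ specAut k₂ τ = _
    rw [reassoc_of% (hF σ), reassoc_of% hSbc, specAut_symm_comp_specAut, Category.comp_id]
    rfl
  let g : (bcFunctor k₂ ℂ).obj B.X ⟶ (bcFunctor k₂ ℂ).obj Y :=
    Over.homMk (pullback.lift (F σ ≫ pullback.fst B.X.hom (bcSpec k₂ ℂ)) (pullback.snd B.X.hom (bcSpec k₂ ℂ)) hw)
      (pullback.lift_snd _ _ _)
  have hg_fst : g.left ≫ pullback.fst Y.hom (bcSpec k₂ ℂ) = F σ ≫ pullback.fst B.X.hom (bcSpec k₂ ℂ) :=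
    pullback.lift_fst _ _ _
  have hg_snd : g.left ≫ pullback.snd Y.hom (bcSpec k₂ ℂ) = pullback.snd B.X.hom (bcSpec k₂ ℂ) :=
    pullback.lift_snd _ _ _
  -- `Aut(ℂ/k₂)`-equivariance
  have hg : ∀ θ : ℂ ≃ₐ[k₂] ℂ, GaloisDescent.gal ℂ B.X θ ≫ g.left = g.left ≫ GaloisDescent.gal ℂ Y θ := by
    intro θ
    have hθ : F ((θ⁻¹).restrictScalars k) = B.gal ℂ θ := by
      rw [hgalF ((θ⁻¹).restrictScalars k) θ⁻¹ (fun z => rfl), inv_inv]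
    have hext' : ∀ x : k₂, ((θ⁻¹).restrictScalars k * σ) (algebraMap k₂ ℂ x) = algebraMap k₂ ℂ (τ⁻¹ x) := by
      intro x
      rw [AlgEquiv.mul_apply, hσ, AlgEquiv.restrictScalars_apply, AlgEquiv.commutes]
    apply pullback.hom_ext
    · rw [Category.assoc, Category.assoc, hg_fst, GaloisDescent.gal_fst, hg_fst, ← gal_eq_gal, ← hθ,
        ← reassoc_of% (hmulF _ σ), comp_fst_eq_of_restrict_eq B F hmulF hgalF σ _ τ⁻¹ hσ hext']
    · rw [Category.assoc, Category.assoc, hg_snd, GaloisDescent.gal_snd, GaloisDescent.gal_snd, reassoc_of% hg_snd]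
  -- descend
  haveI : IsReduced (GaloisDescent.bc ℂ B.X) := inferInstanceAs (IsReduced (B.baseChange ℂ).X.left)
  haveI : IsSeparated Y.hom := by
    change IsSeparated (B.X.hom ≫ specAut k₂ τ)
    infer_instance
  obtain ⟨f, hf, -⟩ := GaloisDescent.existsUnique_map_eq_complex hk₂ g hg
  haveI : IsIso (specAut k₂ τ) :=
    ⟨⟨specAut k₂ τ⁻¹, specAut_comp_specAut_symm k₂ τ, specAut_symm_comp_specAut k₂ τ⟩⟩
  refine ⟨f.left, ?_, ?_⟩
  · have w : f.left ≫ B.X.hom ≫ specAut k₂ τ = B.X.hom := Over.w f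
    rw [← cancel_mono (specAut k₂ τ), Category.assoc, Category.assoc, specAut_symm_comp_specAut, Category.comp_id, w]
  · rw [← hg_fst, ← hf, bcFunctor_map_left_fst]

/-! ## §3 The descent datum on `B` -/

include hF hmulF hgalF in
/-- **Descent of a semilinear `Aut(ℂ/k)`-action on `B ⊗_{k₂} ℂ`, trivial on `Aut(ℂ/k₂)`, to a Galois descent datum on
the `k₂`-model `B`** (Shimura's «for the same reason as in the proof of Proposition 21.1, we can find a `k`-rational
structure»: the `λ_σ` are rational over the finite Galois `k₂` and satisfy `λ_{στ} = λ_σ^τ λ_τ`, so they define descent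
data for `k₂/k`; Milne 2005 Prop. 13.1 supplies the rationality).  Hypotheses: `k → k₂ → ℂ` with `k₂` countable and
every `τ ∈ Aut(k₂/k)` extending to `Aut(ℂ/k)`; `F : Aut(ℂ/k) → End(B_ℂ)` semilinear (`F σ` covers `Spec σ` and respects
`m, 0, i` of `B_ℂ`), multiplicative, and equal to `1 × Spec γ` (`B.gal ℂ γ⁻¹`) for `γ ∈ Aut(ℂ/k₂)`.  Conclusion: an
action `ρ` of `Aut(k₂/k)` on the `k`-scheme `B` with `ρ_τ` covering `Spec τ⁻¹`, compatible with `m, 0, i`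
(the consumer shape of `GaloisDescentAbelianVariety.exists_iso_baseChange`), commuting with every endomorphism of `B`
whose complexification commutes with `F`, and with `F σ ≫ pr = pr ≫ ρ_{τ⁻¹}` for `σ` extending `τ`.
[cite: Shimura1998, §21.1, proof of Prop. 21.1 (pp. 145–146); §21.4, proof of Thm. 21.4 (pp. 147–148)]
[cite: Milne2005ShimuraVarieties, §13 Prop. 13.1 p. 117] [cite: GortzWedhorn2020, §(14.20) and Thm. 14.72 (1)] -/
theorem exists_actionOver_of_semilinear (hk₂ : #k₂ ≤ ℵ₀)
    (hext : ∀ τ : k₂ ≃ₐ[k] k₂, ∃ σ : ℂ ≃ₐ[k] ℂ, ∀ x : k₂, σ (algebraMap k₂ ℂ x) = algebraMap k₂ ℂ (τ x))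
    (hFm : ∀ σ, pullback.map (B.baseChange ℂ).X.hom (B.baseChange ℂ).X.hom (B.baseChange ℂ).X.hom
        (B.baseChange ℂ).X.hom (F σ) (F σ) (Spec.map (CommRingCat.ofHom σ.toRingEquiv.toRingHom))
        (hF σ).symm (hF σ).symm ≫ μ[(B.baseChange ℂ).X].left = μ[(B.baseChange ℂ).X].left ≫ F σ)
    (hFo : ∀ σ, η[(B.baseChange ℂ).X].left ≫ F σ =
      Spec.map (CommRingCat.ofHom σ.toRingEquiv.toRingHom) ≫ η[(B.baseChange ℂ).X].left)
    (hFi : ∀ σ, ι[(B.baseChange ℂ).X].left ≫ F σ = F σ ≫ ι[(B.baseChange ℂ).X].left) :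
    ∃ (ρ : ActionOver (B.X.hom ≫ bcSpec k k₂) (k₂ ≃ₐ[k] k₂))
      (hρ : ∀ τ, (ρ.aut τ).hom ≫ B.X.hom = B.X.hom ≫ specAut k₂ τ⁻¹),
      (∀ τ, GaloisDescentAbelianVariety.aut₂ k₂ B ρ hρ τ ≫ μ[B.X].left = μ[B.X].left ≫ (ρ.aut τ).hom) ∧
      (∀ τ, η[B.X].left ≫ (ρ.aut τ).hom = specAut k₂ τ⁻¹ ≫ η[B.X].left) ∧
      (∀ τ, ι[B.X].left ≫ (ρ.aut τ).hom = (ρ.aut τ).hom ≫ ι[B.X].left) ∧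
      (∀ g : B ⟶ B, (∀ σ, F σ ≫ Hom.toSchemeHom (Hom.baseChange ℂ g) = Hom.toSchemeHom (Hom.baseChange ℂ g) ≫ F σ) →
        ∀ τ, (ρ.aut τ).hom ≫ Hom.toSchemeHom g = Hom.toSchemeHom g ≫ (ρ.aut τ).hom) ∧
      (∀ (σ : ℂ ≃ₐ[k] ℂ) (τ : k₂ ≃ₐ[k] k₂), (∀ x : k₂, σ (algebraMap k₂ ℂ x) = algebraMap k₂ ℂ (τ x)) →
        F σ ≫ pullback.fst B.X.hom (bcSpec k₂ ℂ) = pullback.fst B.X.hom (bcSpec k₂ ℂ) ≫ (ρ.aut τ⁻¹).hom) := by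
  classical
  haveI : Epi (pullback.fst B.X.hom (bcSpec k₂ ℂ)) := inferInstance
  -- for each `τ`: an extension of `τ⁻¹` to `ℂ` and the descended morphism
  choose ext hext' using fun τ : k₂ ≃ₐ[k] k₂ => hext τ⁻¹
  choose f hf₁ hf₂ using fun τ : k₂ ≃ₐ[k] k₂ =>
    exists_descent_of_semilinear B F hF hmulF hgalF hk₂ τ (ext τ) (hext' τ)
  -- `pr ≫ f τ = F σ ≫ pr` for EVERY `σ` extending `τ⁻¹`
  have hstar : ∀ (τ : k₂ ≃ₐ[k] k₂) (σ : ℂ ≃ₐ[k] ℂ), (∀ x : k₂, σ (algebraMap k₂ ℂ x) = algebraMap k₂ ℂ (τ⁻¹ x)) →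
      pullback.fst B.X.hom (bcSpec k₂ ℂ) ≫ f τ = F σ ≫ pullback.fst B.X.hom (bcSpec k₂ ℂ) := fun τ σ hσ => by
    rw [hf₂, comp_fst_eq_of_restrict_eq B F hmulF hgalF σ (ext τ) τ⁻¹ hσ (hext' τ)]
  -- `f 1 = 𝟙`, `f (τ₁τ₂) = f τ₂ ≫ f τ₁`
  have hone' : f 1 = 𝟙 _ := by
    rw [← cancel_epi (pullback.fst B.X.hom (bcSpec k₂ ℂ)), Category.comp_id,
      hstar 1 1 (fun x => by rw [inv_one, AlgEquiv.one_apply, AlgEquiv.one_apply]),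
      hgalF 1 1 (fun _ => rfl), inv_one, gal_one]
    exact Category.id_comp _
  have hmul' : ∀ τ₁ τ₂, f (τ₁ * τ₂) = f τ₂ ≫ f τ₁ := fun τ₁ τ₂ => by
    have h12 : ∀ x : k₂, (ext τ₂ * ext τ₁) (algebraMap k₂ ℂ x) = algebraMap k₂ ℂ ((τ₁ * τ₂)⁻¹ x) := fun x => by
      rw [AlgEquiv.mul_apply, hext' τ₁, hext' τ₂, mul_inv_rev, AlgEquiv.mul_apply]
    rw [← cancel_epi (pullback.fst B.X.hom (bcSpec k₂ ℂ)), hstar (τ₁ * τ₂) (ext τ₂ * ext τ₁) h12, hmulF,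
      Category.assoc, ← hf₂ τ₁, ← Category.assoc, ← hf₂ τ₂, Category.assoc]
  -- the action
  let ρ : ActionOver (B.X.hom ≫ bcSpec k k₂) (k₂ ≃ₐ[k] k₂) :=
    { aut :=
        { toFun := fun τ =>
            { hom := f τ
              inv := f τ⁻¹
              hom_inv_id := by rw [← hmul', inv_mul_cancel, hone']
              inv_hom_id := by rw [← hmul', mul_inv_cancel, hone'] }
          map_one' := Iso.ext hone'
          map_mul' := fun a b => Iso.ext (hmul' a b) }
      aut_comp := fun τ => by
        change f τ ≫ B.X.hom ≫ bcSpec k k₂ = B.X.hom ≫ bcSpec k k₂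
        rw [reassoc_of% (hf₁ τ), specAut_comp_bcSpec] }
  have hρf : ∀ τ, (ρ.aut τ).hom = f τ := fun τ => rfl
  refine ⟨ρ, hf₁, fun τ => ?_, fun τ => ?_, fun τ => ?_, fun g hg τ => ?_, fun σ τ hστ => ?_⟩
  · -- multiplication: checked after the epimorphism `pr × pr : B_ℂ ×_ℂ B_ℂ → B ×_{k₂} B`
    let prr := pullback.map (B.baseChange ℂ).X.hom (B.baseChange ℂ).X.hom B.X.hom B.X.hom
      (pullback.fst B.X.hom (bcSpec k₂ ℂ)) (pullback.fst B.X.hom (bcSpec k₂ ℂ)) (bcSpec k₂ ℂ)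
      pullback.condition.symm pullback.condition.symm
    have hprr : prr = (Functor.Monoidal.μIso (bcFunctor k₂ ℂ) B.X B.X).hom.left ≫
        pullback.fst (B.X ⊗ B.X).hom (bcSpec k₂ ℂ) := (μ_left_comp_fst ℂ B.X B.X).symm
    haveI : Epi (pullback.fst (B.X ⊗ B.X).hom (bcSpec k₂ ℂ)) := inferInstance
    haveI : IsIso (Functor.Monoidal.μIso (bcFunctor k₂ ℂ) B.X B.X).hom.left := inferInstance
    haveI : Epi prr := by rw [hprr]; exact epi_comp _ _
    have hprr_fst : prr ≫ pullback.fst B.X.hom B.X.hom =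
        pullback.fst (B.baseChange ℂ).X.hom (B.baseChange ℂ).X.hom ≫ pullback.fst B.X.hom (bcSpec k₂ ℂ) :=
      pullback.lift_fst _ _ _
    have hprr_snd : prr ≫ pullback.snd B.X.hom B.X.hom =
        pullback.snd (B.baseChange ℂ).X.hom (B.baseChange ℂ).X.hom ≫ pullback.fst B.X.hom (bcSpec k₂ ℂ) :=
      pullback.lift_snd _ _ _
    let R := pullback.map (B.baseChange ℂ).X.hom (B.baseChange ℂ).X.hom (B.baseChange ℂ).X.hom
      (B.baseChange ℂ).X.hom (F (ext τ)) (F (ext τ)) (Spec.map (CommRingCat.ofHom (ext τ).toRingEquiv.toRingHom))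
      (hF (ext τ)).symm (hF (ext τ)).symm
    have hRprr : prr ≫ GaloisDescentAbelianVariety.aut₂ k₂ B ρ hf₁ τ = R ≫ prr := by
      apply pullback.hom_ext
      · rw [Category.assoc, Category.assoc, ← Over.fst_left, GaloisDescentAbelianVariety.aut₂_fst, Over.fst_left,
          reassoc_of% hprr_fst, hprr_fst, hρf, hf₂, pullback.lift_fst_assoc, Category.assoc]
      · rw [Category.assoc, Category.assoc, ← Over.snd_left, GaloisDescentAbelianVariety.aut₂_snd, Over.snd_left,
          reassoc_of% hprr_snd, hprr_snd, hρf, hf₂, pullback.lift_snd_assoc, Category.assoc]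
    rw [← cancel_epi prr, reassoc_of% hRprr, ← mul_baseChange_left_comp_fst_assoc ℂ B,
      ← mul_baseChange_left_comp_fst ℂ B, reassoc_of% (hFm (ext τ)), hρf, hf₂]
  · -- unit: checked after the epimorphism `Spec ℂ → Spec k₂`
    haveI : Surjective (bcSpec k₂ ℂ) := (ProperDescent.fpqc_specMap k₂ ℂ).1.1
    haveI : Flat (bcSpec k₂ ℂ) := (ProperDescent.fpqc_specMap k₂ ℂ).1.2
    haveI : Epi (bcSpec k₂ ℂ) := Flat.epi_of_flat_of_surjective _
    rw [← cancel_epi (bcSpec k₂ ℂ), ← one_baseChange_left_comp_fst_assoc ℂ B, hρf, hf₂,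
      reassoc_of% (hFo (ext τ)), one_baseChange_left_comp_fst ℂ B,
      reassoc_of% (specMap_comp_bcSpec_of_restrict (ext τ) τ⁻¹ (hext' τ))]
  · -- inversion: checked after `pr`
    rw [← cancel_epi (pullback.fst B.X.hom (bcSpec k₂ ℂ)), ← inv_baseChange_left_comp_fst_assoc ℂ B, hρf, hf₂,
      reassoc_of% (hFi (ext τ)), inv_baseChange_left_comp_fst ℂ B, reassoc_of% (hf₂ τ)]
  · -- endomorphisms whose complexification commutes with `F`
    have h1 : pullback.fst B.X.hom (bcSpec k₂ ℂ) ≫ Hom.toSchemeHom g =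
        Hom.toSchemeHom (Hom.baseChange ℂ g) ≫ pullback.fst B.X.hom (bcSpec k₂ ℂ) :=
      (toSchemeHom_baseChange_comp_fst ℂ g).symm
    rw [← cancel_epi (pullback.fst B.X.hom (bcSpec k₂ ℂ)), hρf, reassoc_of% (hf₂ τ), h1, reassoc_of% h1, hf₂,
      reassoc_of% (hg (ext τ))]
  · -- the link
    rw [hρf, hstar τ⁻¹ σ (fun x => by rw [inv_inv]; exact hστ x)]

end Descent

end AbelianVariety

end Literature.AlgebraicGeometry.Motives

end
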